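import Summits.QuantumFields.BalabanUV.Gaps.D1Residue

/-!
# Sketch — crux ideas of seat ym-nodeO-idea-2 on `BalabanUVNodes.EndpointGivenBR13SepCoPH` (stmt-QuantumFields-20543)

First-lemma shapes for the two crux idea cards `af-sign-by-margin` and `regulator-exchange-n7`.
Everything here is conditional finite-𝕋⁴ bookkeeping on route `BalabanUVNodes`; nothing is a continuum / OS / mass-gap statement,
[B12] Thm 2 is unproved in print, and the Clay problem is untouched.
-/

open Finset Filter Topology
open scoped BigOperators
open Literature.MathematicalPhysics.QuantumFieldTheory
open Literature.MathematicalPhysics.QuantumFieldTheory.Balaban1983to89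
open Literature.MathematicalPhysics.QuantumFieldTheory.Balaban1983to89.Beta
open OneStepResolventKernel (JetData)
open OneStepKernelFamily (TbalOf TshotOf)
open B12Beta (secondMoment)
open Summit.QuantumFields.BalabanUV.Gaps.D1Residue (OneShotLaw)

namespace Summit.QuantumFields.YangMills.Cruxes.EndpointGivenBR13SepCoPH.Idea2

/-! ## Card `af-sign-by-margin` -/

/-- SLOPE SURJECTIVITY (the seam that makes K2's `∃ Nc` slope-agnostic): every non-negative slope is `stepBal Nc L`
for some real colour parameter `Nc`, since `stepBal N L = (11N²/12π²)·log L`. -/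
theorem exists_Nc_of_nonneg {s : ℝ} (hs : 0 ≤ s) {L : ℝ} (hL : 1 < L) :
    ∃ Nc : ℝ, B12Normalization.stepBal Nc L = s := by
  have hlog : 0 < Real.log L := Real.log_pos hL
  refine ⟨Real.sqrt (12 * Real.pi ^ 2 * s / (11 * Real.log L)), ?_⟩
  rw [B12Normalization.stepBal_eq, Real.sq_sqrt (by positivity)]
  field_simp

/-- PARA/DIA SIGN-MARGIN LAW for a real sequence `f` (the shape of the card's crux over the pinned one-loop
coefficients `β⁰_j`): from some `j₀` on, `f = P − K` with a PARAMAGNETIC piece `P ≥ p₀ > 0` (a variance: sign-definite by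
positivity of second-order perturbation theory) and a DIAMAGNETIC piece `0 ≤ K ≤ κ·P` with a FIXED fraction `κ < 1`
(sign-definite by the lattice diamagnetic / Kato inequality; `κ` is the margin — `2/12` in background gauge). -/
def SignMarginLaw (f : ℕ → ℝ) : Prop :=
  ∃ (P K : ℕ → ℝ) (κ p₀ : ℝ) (j₀ : ℕ), κ < 1 ∧ 0 < p₀ ∧
    ∀ j, j₀ ≤ j → f j = P j - K j ∧ 0 ≤ K j ∧ K j ≤ κ * P j ∧ p₀ ≤ P j

/-- The sign-margin law gives an EVENTUAL POSITIVE LOWER BOUND `(1 − κ)·p₀` — no lattice integral is evaluated, no rate,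
no telescoping, no colour number. -/
theorem eventualLower_of_signMarginLaw {f : ℕ → ℝ} (h : SignMarginLaw f) :
    ∃ (b : ℝ) (j₀ : ℕ), 0 < b ∧ ∀ j, j₀ ≤ j → b ≤ f j := by
  obtain ⟨P, K, κ, p₀, j₀, hκ, hp₀, hf⟩ := h
  refine ⟨(1 - κ) * p₀, j₀, mul_pos (by linarith) hp₀, fun j hj => ?_⟩
  obtain ⟨hfj, hK0, hKle, hP⟩ := hf j hj
  rw [hfj]
  nlinarith

/-- FIRST LEMMA of the card, instantiated at the typed step kernels: the sign-margin law for
`j ↦ secondMoment (TbalOf Lc Js j) 0 1` yields the eventual positive lower bound that the tree's sign-road END suppliers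
(`FlowStepRuns.endpointExistence_of_eventualLower`, `AssemblyRemainder.endpointExistence_of_limit_remainderConst`) consume
for the one-loop part. -/
theorem beta0_eventualLower_of_signMarginLaw {Lc : ℕ} [NeZero Lc] (Js : ℕ → JetData 3 Lc)
    (h : SignMarginLaw fun j => secondMoment (TbalOf Lc Js j) 0 1) :
    ∃ (b : ℝ) (j₀ : ℕ), 0 < b ∧ ∀ j, j₀ ≤ j → b ≤ secondMoment (TbalOf Lc Js j) 0 1 :=
  eventualLower_of_signMarginLaw h

/-! ## Card `regulator-exchange-n7` -/

/-- REGULATOR EXCHANGE (two-scale decoupling): the lattice one-shot coefficient `f` and a continuum-regulated comparison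
function `g` (same block-average infrared regulator, proper-time / Pauli–Villars ultraviolet regulator) differ by a CONVERGENT
sequence — the Dashen–Gross statement "lattice artefact vertices contribute constants, the logarithm is universal". -/
def RegulatorExchange (f g : ℕ → ℝ) : Prop :=
  ∃ C : ℝ, Tendsto (fun m => f m - g m) atTop (𝓝 C)

/-- PROPER-TIME LAW: the continuum-regulated comparison function runs linearly in the number of blockings `m` with slope
`s` up to a convergent remainder (Seeley–DeWitt `a₂` coefficient × `log Lc` per blocking, by the exact scaling identity of the
proper-time representation). -/
def ProperTimeLaw (g : ℕ → ℝ) (s : ℝ) : Prop :=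
  ∃ C' : ℝ, Tendsto (fun m => g m - s * m) atTop (𝓝 C')

/-- Exchange + proper-time law ⟹ the one-shot coefficient runs with slope `s` up to a UNIFORMLY BOUNDED remainder. -/
theorem oneShot_bdd_of_exchange {f g : ℕ → ℝ} {s : ℝ} (h₁ : RegulatorExchange f g) (h₂ : ProperTimeLaw g s) :
    ∃ U : ℝ, ∀ m : ℕ, |f m - s * m| ≤ U := by
  obtain ⟨C, hC⟩ := h₁
  obtain ⟨C', hC'⟩ := h₂
  have h : Tendsto (fun m => f m - s * m) atTop (𝓝 (C + C')) := by
    have := hC.add hC'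
    refine this.congr' (Eventually.of_forall fun m => ?_)
    ring
  obtain ⟨U, hU⟩ := isBounded_iff_forall_norm_le.1 (Metric.isBounded_range_of_tendsto _ h)
  exact ⟨U, fun m => by simpa [Real.norm_eq_abs] using hU _ (Set.mem_range_self m)⟩

/-- FIRST LEMMA of the card, instantiated: regulator exchange for the typed one-shot family `TshotOf Lc Jc` against a
comparison function obeying the proper-time law AT SLOPE `stepBal N Lc` gives g1-p1's `OneShotLaw Lc Jc N 0 1` — the exact
missing lemma of row (D1) (road FP's leaf N7 / hident), with the colour number PINNED. -/
theorem oneShotLaw_of_exchange {Lc : ℕ} [NeZero Lc] (Jc : ∀ m : ℕ, JetData 3 (Lc ^ m)) (N : ℝ) (g : ℕ → ℝ)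
    (h₁ : RegulatorExchange (fun m => secondMoment (TshotOf Lc Jc m) 0 1) g)
    (h₂ : ProperTimeLaw g (B12Normalization.stepBal N Lc)) : OneShotLaw Lc Jc N 0 1 := by
  obtain ⟨U, hU⟩ := oneShot_bdd_of_exchange h₁ h₂
  exact ⟨U, fun m _ => hU m⟩

end Summit.QuantumFields.YangMills.Cruxes.EndpointGivenBR13SepCoPH.Idea2
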